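/-
Speedrun cell sr-mbsolver / programme hubbard-alg — LIT team (lit-1 gen-21): THEOREM B, `jw-srot` form, for the RAWLOW relaxation with raw block
`ρ₄` AND ONE STAGGERED CHARGE COMPONENT ONLY (FORMAT-ksdn v0.5 `mps-rawlow` + v0.6 AMENDMENT 2 'N-FREE staggered-only':
`model.charge_kinds = ["staggered"]`, the χ8 one-label `S̃z` tensors: `m₀ = 5`, injection `W₃`, bound rule `lmax_psd`, bond labels ONE involutive
label `u` with `u_b = κ − u_a − m(s)` — CERTIFIED #455 (U = 8, ν = ½), #456 (U = 4, ν = ½), #459 (U = 8, ν = ¾), #460 (U = 8, ν = ⅞)) — the kernel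
edge between the BY-VALUE node of such a row and the window level. Theorem-only; T2‴ of the design note HOME/sr-mbsolver-lit-1/HANDOFF.md (gen-20,
14:15Z (c)): NO twirl — the window-side staggered sector zeros are a HYPOTHESIS of the `jw-srot` window statement with staggered-spin sectors
(`Transport/ChainWindowSpinRotationRowsNszb.lean`, `ksdnClaim_of_srotNszbClaim`), which the standard node discharges through the sublattice spin
rotation; that window statement's total-occupation sector hypothesis is simply not used (the `S̃z`-only by-value node has no occupation sectors).
HONEST FRAMING: first certified bounds; not a superconductivity verdict; every number certified or labelled float.

`ksdnSrotNszbClaim_of_mpsRaw4SrotSzTrClaim` = `ksdnSrotNszbClaim_of_mpsRaw6SrotTrClaim` (`Transport/MPSPrimalRaw6SrotNszb.lean`, lit-1 g18) with: the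
raw head block `ρ₆` on `{-1,…,4}` replaced by `ρ₄` on `{-1,…,2}` (coordinates `e₄ : Fin 4 ≃ {-1,…,2}`, `i ↦ i − 1`), the injection `W₅` by
`W₃ = cgMap A 3`, the compressed levels by `ω₅…ω_N` (chain rows from `m = 6`); the site-indexed PAIR charges by ONE site-indexed charge
`qs : ℕ → Fin 4 → ℤ`, `qb : ℕ → β → ℤ` with `A^s_{ab} ≠ 0 ⇒ qb (x+1) b = qb x a + qs x s` and `qs x s = (−1)^x · cm · ([↑ ∈ occ s] − [↓ ∈ occ s])`
(the involutive/staggered rule made additive, `MPSCoarseGraining.covariantAt_of_involutive`), the `ω`-sector tags by `cgTagAt qs qb 0 (m−2)`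
(`Literature/…/MPSCoarseGrainingSectorsAt.lean`); and NO total-occupation sector hypothesis on the by-value variables — only block diagonality in
the STAGGERED spin count `Σ_y ε_y ([↑ ∈ occ k_y] − [↓ ∈ occ k_y])`, `ε_y = −1` on odd / `+1` on even sites. The feasible point is
`exists_mpsRawRowsTr_of_window_loewner_at 3` (`Transport/MPSPrimalRawWindowAt.lean`); the staggered sectors of the relabelled window `ρ^F`
(positions `i`, sign `−(−1)^i` = the parity sign of coordinate `i − 1`) and of the marginal `ρ₄` are inherited from `ρ`
(`spinPartialTrace_apply_eq_zero_of_chargeAt`). Window `N = n + 3 ≥ 5`. CONCLUSION = the hypothesis `hclaim` of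
`Transport.ksdnClaim_of_srotNszbClaim` on `{-1, …, n+1}` with density `ν`. No model beyond `jw-srot`, no definition, no `sorry`, no new
axiom, no named fact.
[cite: KullEtAl2024, §2.3–2.5, §3.3, §4.2, §6.2] [cite: ArakiMoriya2003, §4.1] [cite: PerezGarciaVerstraeteWolfCirac2007, §3.2]
-/
import Summits.Ventures.CertifiedManyBodySolver.Transport.MPSPrimalRawWindowAt
import HarnessLib

noncomputable section

open Matrix Complex Filter Topology
open scoped ComplexOrder Kronecker BigOperators MatrixOrder
open Literature.Probability.LatticeModels
open Literature.MathematicalPhysics.QuantumLattice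
open Literature.MathematicalPhysics.QuantumLattice.HubbardWave0
open Literature.MathematicalPhysics.QuantumLattice.ThermodynamicLimit
open Literature.MathematicalPhysics.QuantumLattice.JordanWigner
open Literature.MathematicalPhysics.QuantumManyBody.StateRelaxation
open Literature.MathematicalPhysics.QuantumLattice.MPSCoarseGraining
open Literature.Computability.QuantumComplexity (traceLeft traceRight)

namespace Summit.Ventures.CertifiedManyBodySolver.Transport

/-! ### The four-site raw window `{-1, 0, 1, 2}` -/

section Window4

/-- `{-1, 0, 1} ⊆ {-1,…,2}`. [folklore] -/
theorem chainWindow_one_subset_two : chainWindow (-1) 1 ⊆ chainWindow (-1) 2 := chainWindow_mono_right (-1) (by norm_num)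

/-- The unit translate of `{-1, 0, 1}` lies in `{-1,…,2}`. [folklore] -/
theorem affShiftSet_chainWindow_one_subset_two : affShiftSet 1 (unitVec 0) (chainWindow (-1) 1) ⊆ chainWindow (-1) 2 :=
  affShiftSet_chainWindow_subset (-1) 1

/-- `-e₀ ∈ {-1,…,2}`. [folklore] -/
theorem neg_unitVec_mem_chainWindow_two : (-unitVec 0 : Site 1) ∈ chainWindow (-1) 2 := neg_unitVec_mem_chainWindow (by norm_num)

/-- `0 ∈ {-1,…,2}`. [folklore] -/
theorem zero_mem_chainWindow_two : (0 : Site 1) ∈ chainWindow (-1) 2 := zero_mem_chainWindow (by norm_num)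

end Window4

/-! ### THEOREM B, `jw-srot` form, RAWLOW with raw block `ρ₄` and ONE staggered-spin charge: the `mps-rawlow(N, D, A)` statement implies the `jw-srot` window statement with staggered sectors -/

section Transport

variable {β : Type*} [Fintype β] [DecidableEq β]

/-- **THEOREM B, `jw-srot` form, RAWLOW with raw block `ρ₄`, `W₃`, `λ_max` bounds AND ONE STAGGERED-SPIN CHARGE, edge form.** Data: window
`N = n+3 ≥ 5` sites; a REAL MPS tensor `A = (A^s)_{s ∈ Fin 4}` on the bond index type `β`, covariant for the SITE-INDEXED charge
`qs x s = (−1)^x·cm·([↑ ∈ occ s] − [↓ ∈ occ s])` with bond charges `qb : ℕ → β → ℤ`; a-priori bounds `B_m ≥ 0` with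
`W_{m−2}ᴴW_{m−2} ≤ B_m·𝟙` (`m = k+5 ≤ N`); coordinates `e₄ : Fin 4 ≃ {-1,…,2}`, `i ↦ i − 1`. HYPOTHESIS `hclaim` = the by-value node of a
`hubbard_jwsrot` `mps-rawlow` row with ONE staggered charge component (N-FREE): over `ρ₄ : Op (PolySite {-1,…,2}) 4` and `ω₅, …, ω_N` —
`ρ₄ ⪰ 0`, `tr ρ₄ = 1`, LTI `tr_{-1} ρ₄ = tr_{2} ρ₄`, STAGGERED-SPIN sector zeros (no occupation sectors), total density of site `-1` equal to
`ν`, real entries, `|ρ₄| ≤ 1`; E5L/E5R with `ρ₄` read through `e₄` then as (first three, last) / (first, last three) and `W₃ = cgMap A 3`;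
E_mL/E_mR (`m = k+6 ≤ N`); `ω_m ⪰ 0`, `cgTagAt qs qb 0 (m−2)` sectors, real, `|ω_m| ≤ B_m`, `Re tr ω_m ≤ B_m` (`m = k+5 ≤ N`); conclusion
`E ≤ Re tr(toSpin(U n_{-1↑}n_{-1↓} − t Σ_σ (c†_{-1σ} c_{0σ̄} + c†_{0σ̄} c_{-1σ})) ρ₄)`. CONCLUSION: the hypothesis `hclaim` of
`Transport.ksdnClaim_of_srotNszbClaim` on `{-1, …, n+1}` with density `ν` (the `jw-srot` window statement with staggered-spin sectors; its
total-occupation sector hypothesis is not used). [cite: KullEtAl2024, §2.3–2.5, §3.3, §4.2, §6.2] [cite: ArakiMoriya2003, §4.1] -/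
theorem ksdnSrotNszbClaim_of_mpsRaw4SrotSzTrClaim (t U : ℝ) (n : ℕ) (hn : 2 ≤ n) (A : Fin 4 → Matrix β β ℂ)
    (hAreal : ∀ s a b, star (A s a b) = A s a b) (qs : ℕ → Fin 4 → ℤ) (qb : ℕ → β → ℤ) (cm : ℤ)
    (hqs : ∀ x s, qs x s =
      (-1 : ℤ) ^ x * cm * ((if (0 : Fin 2) ∈ siteOcc s then 1 else 0 : ℤ) - (if (1 : Fin 2) ∈ siteOcc s then 1 else 0 : ℤ)))
    (hAcov : ∀ x s a b, A s a b ≠ 0 → qb (x + 1) b = qb x a + qs x s)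
    (B : ℕ → ℝ) (hB : ∀ k, k + 5 ≤ n + 3 → 0 ≤ B (k + 5) ∧
      (cgMap A (k + 3))ᴴ * cgMap A (k + 3) ≤ B (k + 5) • (1 : Matrix (Fin (k + 3) → Fin 4) (Fin (k + 3) → Fin 4) ℂ))
    (e₄ : Fin 4 ≃ PolySite (chainWindow (-1) 2)) (he₄ : ∀ i, ofLex (e₄ i).1 0 = ((i : ℕ) : ℤ) - 1)
    {ν E : ℝ}
    (hclaim : ∀ (ρ₄ : Op (PolySite (chainWindow (-1) 2)) 4)
        (ω : ℕ → Matrix (Fin 4 × ((β × β) × Fin 4)) (Fin 4 × ((β × β) × Fin 4)) ℂ),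
      ρ₄.PosSemidef → ρ₄.trace = 1 →
      spinPartialTrace ((PolySite.affEmb 1 (unitVec 0) (chainWindow (-1) 1)).trans
          (PolySite.incl affShiftSet_chainWindow_one_subset_two)) ρ₄ =
        spinPartialTrace (PolySite.incl chainWindow_one_subset_two) ρ₄ →
      (∀ k k' : TensorIndex (PolySite (chainWindow (-1) 2)) 4,
        (∑ y : PolySite (chainWindow (-1) 2), (if Odd (ofLex y.1 0) then (-1 : ℤ) else 1) *
            ((if (0 : Fin 2) ∈ siteOcc (k y) then 1 else 0 : ℤ) - (if (1 : Fin 2) ∈ siteOcc (k y) then 1 else 0 : ℤ))) ≠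
          (∑ y : PolySite (chainWindow (-1) 2), (if Odd (ofLex y.1 0) then (-1 : ℤ) else 1) *
            ((if (0 : Fin 2) ∈ siteOcc (k' y) then 1 else 0 : ℤ) - (if (1 : Fin 2) ∈ siteOcc (k' y) then 1 else 0 : ℤ))) →
        ρ₄ k k' = 0) →
      ((toSpin (nAt (-unitVec 0) neg_unitVec_mem_chainWindow_two 0 +
          nAt (-unitVec 0) neg_unitVec_mem_chainWindow_two 1) * ρ₄).trace).re = ν →
      (∀ k k' : TensorIndex (PolySite (chainWindow (-1) 2)) 4, starRingEnd ℂ (ρ₄ k k') = ρ₄ k k') →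
      (∀ k k' : TensorIndex (PolySite (chainWindow (-1) 2)) 4, ‖ρ₄ k k'‖ ≤ 1) →
      traceLeft (ω 5) = (cgMap A 3 ⊗ₖ (1 : Matrix (Fin 4) (Fin 4) ℂ)) *
          (ρ₄.submatrix (Equiv.arrowCongr e₄ (Equiv.refl (Fin 4))) (Equiv.arrowCongr e₄ (Equiv.refl (Fin 4)))).submatrix
            ((Equiv.prodComm _ _).trans (Fin.snocEquiv fun _ => Fin 4))
            ((Equiv.prodComm _ _).trans (Fin.snocEquiv fun _ => Fin 4)) *
        (cgMap A 3 ⊗ₖ (1 : Matrix (Fin 4) (Fin 4) ℂ))ᴴ →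
      traceRight ((ω 5).submatrix (Equiv.prodAssoc _ _ _) (Equiv.prodAssoc _ _ _)) =
        ((1 : Matrix (Fin 4) (Fin 4) ℂ) ⊗ₖ cgMap A 3) *
          (ρ₄.submatrix (Equiv.arrowCongr e₄ (Equiv.refl (Fin 4))) (Equiv.arrowCongr e₄ (Equiv.refl (Fin 4)))).submatrix
            (Fin.consEquiv fun _ => Fin 4) (Fin.consEquiv fun _ => Fin 4) *
        ((1 : Matrix (Fin 4) (Fin 4) ℂ) ⊗ₖ cgMap A 3)ᴴ →
      (∀ k, k + 6 ≤ n + 3 → traceLeft (ω (k + 6)) =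
        (leftMap A ⊗ₖ (1 : Matrix (Fin 4) (Fin 4) ℂ)) *
          (ω (k + 5)).submatrix (Equiv.prodAssoc _ _ _) (Equiv.prodAssoc _ _ _) *
        (leftMap A ⊗ₖ (1 : Matrix (Fin 4) (Fin 4) ℂ))ᴴ) →
      (∀ k, k + 6 ≤ n + 3 → traceRight ((ω (k + 6)).submatrix (Equiv.prodAssoc _ _ _) (Equiv.prodAssoc _ _ _)) =
        ((1 : Matrix (Fin 4) (Fin 4) ℂ) ⊗ₖ rightMap A) * ω (k + 5) *
        ((1 : Matrix (Fin 4) (Fin 4) ℂ) ⊗ₖ rightMap A)ᴴ) →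
      (∀ k, k + 5 ≤ n + 3 → (ω (k + 5)).PosSemidef) →
      (∀ k, k + 5 ≤ n + 3 → ∀ i j, cgTagAt qs qb 0 (k + 3) i ≠ cgTagAt qs qb 0 (k + 3) j → ω (k + 5) i j = 0) →
      (∀ k, k + 5 ≤ n + 3 → ∀ i j, starRingEnd ℂ (ω (k + 5) i j) = ω (k + 5) i j) →
      (∀ k, k + 5 ≤ n + 3 → ∀ i j, ‖ω (k + 5) i j‖ ≤ B (k + 5)) →
      (∀ k, k + 5 ≤ n + 3 → ((ω (k + 5)).trace).re ≤ B (k + 5)) →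
      E ≤ ((toSpin ((U : ℂ) • (nAt (-unitVec 0) neg_unitVec_mem_chainWindow_two 0 *
            nAt (-unitVec 0) neg_unitVec_mem_chainWindow_two 1) +
          (-(t : ℂ)) • ∑ σ : Fin 2,
            ((cAt (-unitVec 0) neg_unitVec_mem_chainWindow_two σ)ᴴ *
                cAt 0 zero_mem_chainWindow_two σ.rev +
              (cAt 0 zero_mem_chainWindow_two σ.rev)ᴴ *
                cAt (-unitVec 0) neg_unitVec_mem_chainWindow_two σ)) * ρ₄).trace).re) :
    ∀ ρ : Op (PolySite (chainWindow (-1) ((n : ℤ) + 1))) 4, ρ.PosSemidef → ρ.trace = 1 →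
      spinPartialTrace ((PolySite.affEmb 1 (unitVec 0) (chainWindow (-1) (n : ℤ))).trans
          (PolySite.incl (affShiftSet_chainWindow_subset (-1) (n : ℤ)))) ρ =
        spinPartialTrace (PolySite.incl (chainWindow_mono_right (-1) (by omega : (n : ℤ) ≤ n + 1))) ρ →
      (∀ k k' : TensorIndex (PolySite (chainWindow (-1) ((n : ℤ) + 1))) 4,
        (∑ x, (siteOcc (k x)).card) ≠ (∑ x, (siteOcc (k' x)).card) → ρ k k' = 0) →
      (∀ k k' : TensorIndex (PolySite (chainWindow (-1) ((n : ℤ) + 1))) 4,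
        (∑ y : PolySite (chainWindow (-1) ((n : ℤ) + 1)), (if Odd (ofLex y.1 0) then (-1 : ℤ) else 1) *
            ((if (0 : Fin 2) ∈ siteOcc (k y) then 1 else 0 : ℤ) - (if (1 : Fin 2) ∈ siteOcc (k y) then 1 else 0 : ℤ))) ≠
          (∑ y : PolySite (chainWindow (-1) ((n : ℤ) + 1)), (if Odd (ofLex y.1 0) then (-1 : ℤ) else 1) *
            ((if (0 : Fin 2) ∈ siteOcc (k' y) then 1 else 0 : ℤ) - (if (1 : Fin 2) ∈ siteOcc (k' y) then 1 else 0 : ℤ))) →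
        ρ k k' = 0) →
      ((toSpin (nAt (-unitVec 0) (neg_unitVec_mem_chainWindow (by omega : (-1 : ℤ) ≤ n + 1)) 0 +
          nAt (-unitVec 0) (neg_unitVec_mem_chainWindow (by omega : (-1 : ℤ) ≤ n + 1)) 1) * ρ).trace).re = ν →
      (∀ k k' : TensorIndex (PolySite (chainWindow (-1) ((n : ℤ) + 1))) 4, starRingEnd ℂ (ρ k k') = ρ k k') →
      (∀ k k' : TensorIndex (PolySite (chainWindow (-1) ((n : ℤ) + 1))) 4, ‖ρ k k'‖ ≤ 1) →
      E ≤ ((toSpin ((U : ℂ) • (nAt (-unitVec 0) (neg_unitVec_mem_chainWindow (by omega : (-1 : ℤ) ≤ n + 1)) 0 *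
            nAt (-unitVec 0) (neg_unitVec_mem_chainWindow (by omega : (-1 : ℤ) ≤ n + 1)) 1) +
          (-(t : ℂ)) • ∑ σ : Fin 2,
            ((cAt (-unitVec 0) (neg_unitVec_mem_chainWindow (by omega : (-1 : ℤ) ≤ n + 1)) σ)ᴴ *
                cAt 0 (zero_mem_chainWindow (by omega : (0 : ℤ) ≤ n + 1)) σ.rev +
              (cAt 0 (zero_mem_chainWindow (by omega : (0 : ℤ) ≤ n + 1)) σ.rev)ᴴ *
                cAt (-unitVec 0) (neg_unitVec_mem_chainWindow (by omega : (-1 : ℤ) ≤ n + 1)) σ)) * ρ).trace).re := by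
  intro ρ hpsd htr hLTI _hsec hstag hdens hreal _hbd
  classical
  -- the windows `W₄ = {-1,…,2} ⊆ W = {-1,…,n+1}` and the shifts of the LTI embeddings
  have hW4 : chainWindow (-1) 2 ⊆ chainWindow (-1) ((n : ℤ) + 1) := chainWindow_mono_right (-1) (by omega)
  have hlow4 : IsLowerSet (Set.range (PolySite.incl hW4)) := isLowerSet_range_incl_chainWindow hW4
  have hφ₀ := shift_incl (chainWindow_mono_right (-1) (by omega : (n : ℤ) ≤ n + 1))
  have hφ₁ : ∀ y, ofLex (((PolySite.affEmb 1 (unitVec 0) (chainWindow (-1) (n : ℤ))).trans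
      (PolySite.incl (affShiftSet_chainWindow_subset (-1) (n : ℤ)))) y).1 0 = ofLex y.1 0 + 1 := fun y => by
    rw [shift_affEmb_trans_incl, chain_unitVec_apply_zero]
  -- (i) coordinates and the relabelled window variable `ρ^F`
  obtain ⟨eN, heN⟩ := exists_finEquiv_chainWindow (n + 3) ((n : ℤ) + 1) (by push_cast; ring)
  obtain ⟨e', he'⟩ := exists_finEquiv_chainWindow (n + 2) (n : ℤ) (by push_cast; ring)
  set ρF : Op (Fin (n + 3)) 4 := spinPartialTrace eN.toEmbedding ρ with hρFdef
  have hFpsd : ρF.PosSemidef := posSemidef_spinPartialTrace _ hpsd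
  have hFtr : ρF.trace = 1 := by rw [hρFdef, trace_spinPartialTrace, htr]
  have hsucc : (Fin.succEmb (n + 2)).trans eN.toEmbedding =
      e'.toEmbedding.trans ((PolySite.affEmb 1 (unitVec 0) (chainWindow (-1) (n : ℤ))).trans
        (PolySite.incl (affShiftSet_chainWindow_subset (-1) (n : ℤ)))) := by
    refine embedding_eq_of_coord_eq fun i => ?_
    rw [Function.Embedding.trans_apply, Function.Embedding.trans_apply, Equiv.coe_toEmbedding, Equiv.coe_toEmbedding, heN,
      hφ₁, he', Fin.coe_succEmb, Fin.val_succ]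
    push_cast
    ring
  have hcast : (Fin.castSuccEmb : Fin (n + 2) ↪ Fin (n + 3)).trans eN.toEmbedding =
      e'.toEmbedding.trans (PolySite.incl (chainWindow_mono_right (-1) (by omega : (n : ℤ) ≤ n + 1))) := by
    refine embedding_eq_of_coord_eq fun i => ?_
    rw [Function.Embedding.trans_apply, Function.Embedding.trans_apply, Equiv.coe_toEmbedding, Equiv.coe_toEmbedding, heN,
      hφ₀, he', Fin.coe_castSuccEmb, Fin.val_castSucc, add_zero]
  have hFLTI : spinPartialTrace (Fin.succEmb (n + 2)) ρF = spinPartialTrace Fin.castSuccEmb ρF := by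
    rw [hρFdef, ← spinPartialTrace_trans, ← spinPartialTrace_trans, hsucc, hcast, spinPartialTrace_trans e'.toEmbedding,
      spinPartialTrace_trans e'.toEmbedding, hLTI]
  -- staggered-spin sectors of `ρ^F`: the big window's parity sign read at position `i` is `-(-1)^i` (coordinate `i - 1`)
  have hsign : ∀ i : Fin (n + 3), (if Odd (ofLex (eN i).1 0) then (-1 : ℤ) else 1) = -((-1 : ℤ) ^ (i : ℕ)) := by
    intro i
    rw [heN]
    rcases Nat.even_or_odd (i : ℕ) with h | h
    · rw [h.neg_one_pow, if_pos]
      rcases h with ⟨r, hr⟩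
      exact ⟨(r : ℤ) - 1, by omega⟩
    · rw [h.neg_one_pow, neg_neg, if_neg]
      rcases h with ⟨r, hr⟩
      rintro ⟨r', hr'⟩
      omega
  -- the scalar charge of a configuration of the relabelled window is `-cm ×` its staggered spin count (parity sign `-(-1)^i` at position `i`)
  have hmul : ∀ w : TensorIndex (Fin (n + 3)) 4, (∑ x : Fin (n + 3), qs (x : ℕ) (w x)) =
      (-cm) * ∑ i : Fin (n + 3), (-((-1 : ℤ) ^ (i : ℕ))) *
        ((if (0 : Fin 2) ∈ siteOcc (w i) then 1 else 0 : ℤ) - (if (1 : Fin 2) ∈ siteOcc (w i) then 1 else 0 : ℤ)) := by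
    intro w
    rw [Finset.mul_sum]
    exact Finset.sum_congr rfl fun x _ => by rw [hqs]; ring
  have hFstag : ∀ u v : TensorIndex (Fin (n + 3)) 4,
      (∑ i : Fin (n + 3), (-((-1 : ℤ) ^ (i : ℕ))) *
          ((if (0 : Fin 2) ∈ siteOcc (u i) then 1 else 0 : ℤ) - (if (1 : Fin 2) ∈ siteOcc (u i) then 1 else 0 : ℤ))) ≠
        (∑ i : Fin (n + 3), (-((-1 : ℤ) ^ (i : ℕ))) *
          ((if (0 : Fin 2) ∈ siteOcc (v i) then 1 else 0 : ℤ) - (if (1 : Fin 2) ∈ siteOcc (v i) then 1 else 0 : ℤ))) →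
      ρF u v = 0 := by
    intro u v huv
    refine spinPartialTrace_apply_eq_zero_of_chargeAt
      (fun (y : PolySite (chainWindow (-1) ((n : ℤ) + 1))) (s : Fin 4) => (if Odd (ofLex y.1 0) then (-1 : ℤ) else 1) *
        ((if (0 : Fin 2) ∈ siteOcc s then 1 else 0 : ℤ) - (if (1 : Fin 2) ∈ siteOcc s then 1 else 0 : ℤ)))
      eN.toEmbedding hstag ?_
    simpa only [Equiv.coe_toEmbedding, hsign] using huv
  have hFsec : ∀ u v : TensorIndex (Fin (n + 3)) 4,
      (∑ x : Fin (n + 3), qs (x : ℕ) (u x)) ≠ (∑ x : Fin (n + 3), qs (x : ℕ) (v x)) → ρF u v = 0 := by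
    intro u v huv
    refine hFstag u v fun h => huv ?_
    rw [hmul, hmul, h]
  have hFstar : ∀ u v, star (ρF u v) = ρF u v := fun u v => by
    have := conj_spinPartialTrace_apply eN.toEmbedding hreal u v
    rwa [starRingEnd_apply] at this
  -- (ii) the model-independent core: KSDN's `ω_m = C_{m−2}(ρ^F|_{first m})`
  obtain ⟨ω, hE4L, hE4R, hEmL, hEmR, hωpsd, hωsec, hωreal, hωbd, hωtr⟩ :=
    exists_mpsRawRowsTr_of_window_loewner_at 3 (n + 1) (by norm_num) (show 3 ≤ n + 1 by omega) A hAreal qs qb hAcov B hB ρF hFpsd hFtr hFLTI hFsec hFstar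
  -- (iii) the four-site marginal `ρ₄` and its rows
  set ρ₄ : Op (PolySite (chainWindow (-1) 2)) 4 := spinPartialTrace (PolySite.incl hW4) ρ with hρ₄def
  have h4psd : ρ₄.PosSemidef := posSemidef_spinPartialTrace _ hpsd
  have h4tr : ρ₄.trace = 1 := by rw [hρ₄def, trace_spinPartialTrace, htr]
  have h4LTI : spinPartialTrace ((PolySite.affEmb 1 (unitVec 0) (chainWindow (-1) 1)).trans
        (PolySite.incl affShiftSet_chainWindow_one_subset_two)) ρ₄ =
      spinPartialTrace (PolySite.incl chainWindow_one_subset_two) ρ₄ := by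
    rw [hρ₄def, ← spinPartialTrace_trans, ← spinPartialTrace_trans]
    refine spinPartialTrace_eq_of_shift hφ₀ hφ₁ hLTI 1 ?_ ?_
    · intro y
      rw [shift_trans (shift_affEmb_trans_incl (unitVec (0 : Fin 1)) affShiftSet_chainWindow_one_subset_two)
        (shift_incl hW4), chain_unitVec_apply_zero]
      push_cast
      ring
    · intro y
      rw [shift_trans (shift_incl chainWindow_one_subset_two) (shift_incl hW4), add_zero]
  have h4stag : ∀ k k' : TensorIndex (PolySite (chainWindow (-1) 2)) 4,
      (∑ y : PolySite (chainWindow (-1) 2), (if Odd (ofLex y.1 0) then (-1 : ℤ) else 1) *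
          ((if (0 : Fin 2) ∈ siteOcc (k y) then 1 else 0 : ℤ) - (if (1 : Fin 2) ∈ siteOcc (k y) then 1 else 0 : ℤ))) ≠
        (∑ y : PolySite (chainWindow (-1) 2), (if Odd (ofLex y.1 0) then (-1 : ℤ) else 1) *
          ((if (0 : Fin 2) ∈ siteOcc (k' y) then 1 else 0 : ℤ) - (if (1 : Fin 2) ∈ siteOcc (k' y) then 1 else 0 : ℤ))) →
      ρ₄ k k' = 0 := by
    intro k k' h
    refine spinPartialTrace_apply_eq_zero_of_chargeAt
      (fun (y : PolySite (chainWindow (-1) ((n : ℤ) + 1))) (s : Fin 4) => (if Odd (ofLex y.1 0) then (-1 : ℤ) else 1) *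
        ((if (0 : Fin 2) ∈ siteOcc s then 1 else 0 : ℤ) - (if (1 : Fin 2) ∈ siteOcc s then 1 else 0 : ℤ)))
      (PolySite.incl hW4) hstag ?_
    exact h
  have h4dens : ((toSpin (nAt (-unitVec 0) neg_unitVec_mem_chainWindow_two 0 +
      nAt (-unitVec 0) neg_unitVec_mem_chainWindow_two 1) * ρ₄).trace).re = ν := by
    rw [hρ₄def, trace_toSpin_mul_spinPartialTrace_incl hW4 hlow4, fermionEmbed_add, fermionEmbed_incl_nAt,
      fermionEmbed_incl_nAt]
    exact hdens
  have h4real : ∀ k k' : TensorIndex (PolySite (chainWindow (-1) 2)) 4, starRingEnd ℂ (ρ₄ k k') = ρ₄ k k' :=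
    fun k k' => conj_spinPartialTrace_apply (PolySite.incl hW4) hreal k k'
  have h4bd : ∀ k k' : TensorIndex (PolySite (chainWindow (-1) 2)) 4, ‖ρ₄ k k'‖ ≤ 1 :=
    norm_apply_le_one_of_posSemidef h4psd h4tr
  -- `ρ^F|_{first 4}` is `ρ₄` read through `e₄`
  have hemb : (Fin.castLEEmb (show 3 + 1 ≤ n + 3 by omega)).trans eN.toEmbedding =
      e₄.toEmbedding.trans (PolySite.incl hW4) := by
    refine embedding_eq_of_coord_eq fun i => ?_
    rw [Function.Embedding.trans_apply, Function.Embedding.trans_apply, Equiv.coe_toEmbedding, Equiv.coe_toEmbedding, heN,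
      Fin.castLEEmb_apply, Fin.val_castLE]
    change _ = ofLex (e₄ i).1 0
    rw [he₄]
  have hlink : headMarginal (show 3 + 1 ≤ n + 1 + 2 by omega) ρF =
      ρ₄.submatrix (Equiv.arrowCongr e₄ (Equiv.refl (Fin 4))) (Equiv.arrowCongr e₄ (Equiv.refl (Fin 4))) := by
    rw [headMarginal, hρFdef, ← spinPartialTrace_trans, hemb, spinPartialTrace_trans, spinPartialTrace_equiv]
    ext u v
    rw [reindexOp_apply, Matrix.submatrix_apply]
    rfl
  rw [hlink] at hE4L hE4R
  -- (iv) apply the `mps` claim and move the objective back to the big window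
  have hE := hclaim ρ₄ ω h4psd h4tr h4LTI h4stag h4dens h4real h4bd hE4L hE4R hEmL hEmR hωpsd hωsec hωreal hωbd hωtr
  rw [hρ₄def, trace_toSpin_mul_spinPartialTrace_incl hW4 hlow4] at hE
  simp only [fermionEmbed_add, fermionEmbed_smul, fermionEmbed_sum, fermionEmbed_mul, fermionEmbed_conjTranspose,
    fermionEmbed_incl_nAt, fermionEmbed_incl_cAt] at hE
  exact hE

end Transport

end Summit.Ventures.CertifiedManyBodySolver.Transport

end
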